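import Summits.ResolutionOfSingularities.ResolutionOfSingularities.Theorems.PurelyInseparableDim4PiPlateauOmegaMoveLaw
import HarnessLib

/-!
# Ω move law at every exponent `q = p^e`: an EXTREMAL Moh jump activates the child; `ω_q′ ≤ ω_q + [V_q = 0]·(p^{e−1} − 1)`

[OURS · counted 0 · AI kernel work, weaker than expert review]  Nothing here is a statement about resolution of
singularities in dimension ≥ 4 / characteristic `p`, which is NOT proved.  Sequel of `…PiPlateauOmegaMoveLaw`
(there: `e = 1`, and at general `e` Moh's bound `d′ ≤ d + p^{e−1}` plus term `A` under `q ∣ ord₀ F′`).  Here the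
`q ∣ ord₀ F′` proviso is REMOVED in the extremal case, which is all the move law needs:

* `exists_initial_of_shade_add_pow_le` (bookkept letters, the tree's point-blow-up model `PointBlowup.step`): if the
  shade of a cleaned state of order `o ≥ q = p^e` rises by (at least, hence exactly) `p^{e−1}` at a point `b` of the
  `y_j`-chart, then some LOST exceptional index `i₀ ≠ j` (`b_{i₀} ≠ 0`) carries an INITIAL monomial `y^E` of the child
  with `q ∤ E_{i₀}`.  Proof = the tree's Hasse probe (`PointBlowup.exists_support_step_of_choose_ne_zero'`) at the digit
  `k < e` supplied by `necessary_of_shadeIncreases_pow` (iii): its monomial has `|E| ≤ |r′| + shade + min(p^k, r_{i₀})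
  ≤ |r′| + shade + p^{e−1} = |r′| + shade′ = ord₀ F′`, so it is initial (and `k = e − 1` is forced).
* **`isVActive_step_of_residualOrder_add_pow_le`** (literal letters of `…PiPlateauStatement`): on a MODE-0 edge
  (`t j = 0`) from a clean `q`-fold state, `d + p^{e−1} ≤ d′` forces `V_q′ = 1`.
* **`omegaLetter_step_le_add_of_not_isVActive`**: from a clean `q`-fold `V_q`-INACTIVE state, `ω_q′ ≤ ω_q + (p^{e−1} − 1)`;
  with Π's `omegaLetter_step_le` (`V_q`-active: `ω_q′ ≤ ω_q`) this is res-dim4-idea-5's full MOVE LAW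
  **`omegaLetter_move_law`: `ω_q′ ≤ ω_q + [V_q = 0]·(p^{e−1} − 1)`** on every MODE-0 edge from a clean `q`-fold state,
  every `e ≥ 1`, every field of characteristic `p`, any number of variables (at `e = 1` it is `omegaLetter_mode0_le`).
* `rise_dictionary_pow`: every rise starts at a `V_q`-inactive parent; an extremal one (`= p^{e−1}`) ends at a
  `V_q`-active child.

HONEST LABEL.  Moh's bound and the Hasse probe are PRINT ([Moh1987] §1; [HauserPerlega2019PRIMS] §3 (7)–(9), §5),
kernel-checked in the tree's point-blow-up files by earlier cells; the extremal-case reading and the literal-letter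
transfer are this cell's (res-dim4-idea-5's move law, idea-5 OUTCOMES block 1cda6b53f08a322f: «NOT OURS: the V_q = 0
half … rests on print»).  `ω_q` may RISE at `e ≥ 2` (by at most `p^{e−1} − 1` per V-inactive edge): this is a
bound, not a monotonicity, and says nothing against the Hauser–Perlega cycles (`ResidualOrderUnbounded`); standing
no-go (C) untouched; MODE 0 only; nothing about termination.  Typed and proved by res-dim4-typ-1 (g2).
Supports stmt-ResolutionOfSingularities-16155 (helper).  bears_on: LADDER-RESOLUTION:D157-DOOR2 (res-dim4-pi · Π line · ω move law, every e).
-/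

set_option linter.dupNamespace false -- mandated namespace of this single-conjunct summit

namespace Summit.ResolutionOfSingularities.ResolutionOfSingularities.Theorems.PIDim4

namespace Plateau

open MvPolynomial Finset
open Literature.AlgebraicGeometry.Resolution
open Literature.AlgebraicGeometry.Resolution.Hauser2010
open Literature.AlgebraicGeometry.Resolution.CentreBlowup
open Literature.Barriers.ResolutionOfSingularities
open Literature.Barriers.ResolutionOfSingularities.HauserPerlega
open Summit.ResolutionOfSingularities.ResolutionOfSingularities.Theorems.Rescue.BedCylinderTransport
  (residualOrder_eq_ordZero_sub forall_le_degree_of_ordZero_eq)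

variable {σ : Type*} [Fintype σ] [DecidableEq σ] {K : Type*} [Field K] [DecidableEq K]

/-! ## §1 Bookkept letters: an extremal jump has an initial probe monomial -/

/-- **Extremal Moh jump ⇒ Moh's term `A`, every `e`** (point-blow-up model of `PointBlowupShade.lean`, bookkept
letters): for a cleaned state `s = (F, r)` of order `o ≥ q = p^e` with `y^r ∣ F`, if at the point `b` of the
`y_j`-chart (`b_j = 0`) the shade rises by at least `p^{e−1}` — hence by exactly `p^{e−1}`, `PointBlowup.mohBound` —
then some lost exceptional index `i₀ ≠ j` (`b_{i₀} ≠ 0`, `r_{i₀} ≠ 0`) carries an INITIAL monomial `y^E` of the child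
(`|E| = ord₀ F′`) with `q ∤ E_{i₀}`. [cite: Moh1987, §1 p. 972 (Statement, term A)]
[cite: HauserPerlega2019PRIMS, §5 (proof of the Theorem, assertion (9))] -/
theorem exists_initial_of_shade_add_pow_le (p : ℕ) [Fact p.Prime] [CharP K p] {e : ℕ} (j : σ) (b : σ → K)
    (hbj : b j = 0) (s : PointBlowup.State σ K) (hclean : deletePthPowers (p ^ e) s.F = s.F) {o : ℕ}
    (ho : ordZero s.F = o) (hqo : p ^ e ≤ o) (hr : ∀ d ∈ s.F.support, s.r ≤ d)
    (hext : s.shade + ((p ^ (e - 1) : ℕ) : ℕ∞) ≤ (PointBlowup.step (p ^ e) j b s).shade)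
    {o₁ : ℕ} (ho₁ : ordZero (PointBlowup.step (p ^ e) j b s).F = o₁) :
    ∃ i₀, i₀ ≠ j ∧ b i₀ ≠ 0 ∧ s.r i₀ ≠ 0 ∧
      ∃ E ∈ (PointBlowup.step (p ^ e) j b s).F.support, E.degree = o₁ ∧ ¬ p ^ e ∣ E i₀ := by
  -- the shade does increase
  have hro : s.r.degree ≤ o := by
    obtain ⟨⟨d₀, hd₀, hd₀deg⟩, -⟩ := (ordZero_eq_nat_iff _ _).mp ho
    exact hd₀deg ▸ PointBlowup.degree_le_degree_of_le (hr d₀ (MvPolynomial.mem_support_iff.mpr hd₀))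
  have hsh : s.shade = ((o - s.r.degree : ℕ) : ℕ∞) := PointBlowup.shade_eq_of_ordZero_eq s ho
  have hsh₁ : (PointBlowup.step (p ^ e) j b s).shade = ((o₁ - (PointBlowup.step (p ^ e) j b s).r.degree : ℕ) : ℕ∞) :=
    PointBlowup.shade_eq_of_ordZero_eq _ ho₁
  have hπ : 1 ≤ p ^ (e - 1) := Nat.one_le_pow _ _ (Fact.out : p.Prime).pos
  have hinc : PointBlowup.ShadeIncreases (p ^ e) j b s := by
    unfold PointBlowup.ShadeIncreases
    refine lt_of_lt_of_le ?_ hext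
    rw [hsh, ← ENat.coe_add, Nat.cast_lt]
    omega
  obtain ⟨-, -, i₀, hi₀, hbi₀, hri₀, d₀, hd₀, hd₀deg, hd₀i⟩ :=
    PointBlowup.necessary_of_shadeIncreases_pow p j b hbj s hclean ho hqo hr hinc
  obtain ⟨k, hk, hk0⟩ := exists_natCast_choose_prime_pow_ne_zero p K hd₀i
  obtain ⟨E, hE, hEi₀, -, hEdeg⟩ :=
    PointBlowup.exists_support_step_of_choose_ne_zero' p j b hbj s ho hqo hr hi₀ hk hd₀ hd₀deg hk0
  refine ⟨i₀, hi₀, hbi₀, hri₀, E, hE, ?_, hEi₀⟩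
  -- degree arithmetic of the probe: `|E| ≤ |r′| + shade + min(p^k, r_{i₀})`
  have ha : p ^ k ≤ d₀ i₀ := by
    by_contra hlt
    exact hk0 (by rw [Nat.choose_eq_zero_of_lt (not_le.mp hlt), Nat.cast_zero])
  have hrmo : (s.r - Finsupp.single i₀ (p ^ k)).degree + p ^ k ≤ o := by
    have hle : (s.r - Finsupp.single i₀ (p ^ k)) + Finsupp.single i₀ (p ^ k) ≤ d₀ := by
      rw [Finsupp.le_def]
      intro i
      rw [Finsupp.add_apply, Finsupp.tsub_apply, Finsupp.single_apply]
      by_cases hi : i₀ = i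
      · subst hi; rw [if_pos rfl]
        have := Finsupp.le_def.mp (hr d₀ hd₀) i₀
        omega
      · rw [if_neg hi, add_zero, Nat.sub_zero]
        exact Finsupp.le_def.mp (hr d₀ hd₀) i
    have := PointBlowup.degree_le_degree_of_le hle
    rw [map_add, Finsupp.degree_single, hd₀deg] at this
    exact this
  have hb := PointBlowup.hasseProbe_bound_le j b hbj s ho i₀ hrmo (q := p ^ e)
  have h1 : E.degree ≤ (PointBlowup.step (p ^ e) j b s).r.degree + ((o - s.r.degree) + min (p ^ k) (s.r i₀)) := by
    show E.degree ≤ (PointBlowup.newMult (p ^ e) j b s).degree + _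
    omega
  -- `p^k ≤ p^(e-1)` and the extremal hypothesis give `|E| ≤ o₁`; `E ∈ supp F′` gives `o₁ ≤ |E|`
  have hk' : p ^ k ≤ p ^ (e - 1) := Nat.pow_le_pow_right (Fact.out : p.Prime).pos (by omega)
  have hmin : min (p ^ k) (s.r i₀) ≤ p ^ (e - 1) := (min_le_left _ _).trans hk'
  have ho₁E : o₁ ≤ E.degree := PointBlowup.le_degree_of_ordZero_eq _ ho₁ E hE
  rw [hsh, hsh₁, ← ENat.coe_add, Nat.cast_le] at hext
  omega

/-! ## §2 Literal letters: an extremal rise activates the child -/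

/-- **AN EXTREMAL RISE ACTIVATES THE CHILD, every `e`**: on a MODE-0 edge (`t j = 0`) from a clean `q`-fold state
(`q = p^e`), if the literal residual order rises by (at least, hence exactly) `p^{e−1}`, the child is `V_q`-ACTIVE.
[cite: Moh1987, §1 p. 972 (Statement, term A)] -/
theorem isVActive_step_of_residualOrder_add_pow_le (p : ℕ) [Fact p.Prime] [CharP K p] (e : ℕ) (s : CState σ K)
    (j : σ) (t : σ → K) (ht : t j = 0) (hclean : IsClean (p ^ e) s.F) (hq : ((p ^ e : ℕ) : ℕ∞) ≤ ordZero s.F)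
    (hF0 : s.F ≠ 0)
    (hext : residualOrder s.exc s.F + ((p ^ (e - 1) : ℕ) : ℕ∞) ≤
      residualOrder (CentreBlowup.step (p ^ e) Finset.univ j t s).exc (CentreBlowup.step (p ^ e) Finset.univ j t s).F) :
    IsVActive (p ^ e) (CentreBlowup.step (p ^ e) Finset.univ j t s).exc
      (CentreBlowup.step (p ^ e) Finset.univ j t s).F := by
  have hr : ∀ b ∈ s.F.support, exceptionalExp s.exc s.F ≤ b :=
    fun b hb => exceptionalExp_le_exponent_of_mem_support s.exc hb
  have hne : (CentreBlowup.step (p ^ e) Finset.univ j t s).F ≠ 0 :=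
    step_F_ne_zero_of_isClean p e s j t ht hclean hF0 hq
  have hclean' : deletePthPowers (p ^ e) (⟨s.F, exceptionalExp s.exc s.F⟩ : PointBlowup.State σ K).F =
      (⟨s.F, exceptionalExp s.exc s.F⟩ : PointBlowup.State σ K).F := deletePthPowers_eq_self hclean
  obtain ⟨o, ho⟩ := exists_ordZero_eq_natCast hF0
  have hqo : p ^ e ≤ o := by rw [ho] at hq; exact_mod_cast hq
  have hFeq := step_univ_F_eq_pointStep (p ^ e) j t s (exceptionalExp s.exc s.F)
  obtain ⟨o₁, ho₁⟩ := exists_ordZero_eq_natCast hne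
  have ho₁' : ordZero (PointBlowup.step (p ^ e) j t (⟨s.F, exceptionalExp s.exc s.F⟩ : PointBlowup.State σ K)).F =
      o₁ := by rwa [← hFeq]
  -- extremal in bookkept letters of the literal point state
  have hext' : (⟨s.F, exceptionalExp s.exc s.F⟩ : PointBlowup.State σ K).shade + ((p ^ (e - 1) : ℕ) : ℕ∞) ≤
      (PointBlowup.step (p ^ e) j t (⟨s.F, exceptionalExp s.exc s.F⟩ : PointBlowup.State σ K)).shade := by
    rw [shade_literal_eq]
    exact hext.trans (residualOrder_step_le_shade_pointStep (p ^ e) ht s ho hne)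
  obtain ⟨i₀, -, hti₀, -, E, hE, hEdeg, hEi₀⟩ :=
    exists_initial_of_shade_add_pow_le p j t ht _ hclean' ho hqo hr hext' ho₁'
  refine ⟨E, by rwa [hFeq], ?_, i₀, not_mem_exc_step_of_ne_zero (p ^ e) ht s hti₀, hEi₀⟩
  rw [ho₁]
  exact_mod_cast hEdeg

/-- **THE RISE DICTIONARY, every `e`**: a rise of the literal residual order on a MODE-0 edge from a clean `q`-fold
state starts at a `V_q`-INACTIVE parent and is at most `p^{e−1}`; an EXTREMAL rise (`= p^{e−1}`) ends at a
`V_q`-ACTIVE child. [folklore] -/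
theorem rise_dictionary_pow (p : ℕ) [Fact p.Prime] [CharP K p] {e : ℕ} (he : 1 ≤ e) (s : CState σ K) (j : σ)
    (t : σ → K) (ht : t j = 0) (hclean : IsClean (p ^ e) s.F) (hq : ((p ^ e : ℕ) : ℕ∞) ≤ ordZero s.F)
    (hlt : residualOrder s.exc s.F <
      residualOrder (CentreBlowup.step (p ^ e) Finset.univ j t s).exc (CentreBlowup.step (p ^ e) Finset.univ j t s).F) :
    ¬ IsVActive (p ^ e) s.exc s.F ∧
      residualOrder (CentreBlowup.step (p ^ e) Finset.univ j t s).exc (CentreBlowup.step (p ^ e) Finset.univ j t s).F ≤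
        residualOrder s.exc s.F + ((p ^ (e - 1) : ℕ) : ℕ∞) ∧
      (residualOrder (CentreBlowup.step (p ^ e) Finset.univ j t s).exc (CentreBlowup.step (p ^ e) Finset.univ j t s).F =
          residualOrder s.exc s.F + ((p ^ (e - 1) : ℕ) : ℕ∞) →
        IsVActive (p ^ e) (CentreBlowup.step (p ^ e) Finset.univ j t s).exc
          (CentreBlowup.step (p ^ e) Finset.univ j t s).F) :=
  ⟨not_isVActive_of_residualOrder_lt p e s j t ht hq hlt,
    residualOrder_step_le_add_pow p he s j t ht hclean hq,
    fun heq => isVActive_step_of_residualOrder_add_pow_le p e s j t ht hclean hq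
      (F_ne_zero_of_residualOrder_lt s hlt) heq.symm.le⟩

/-! ## §3 The move law of `ω_q` at every `e` -/

/-- **Ω, the `V_q`-INACTIVE HALF at every `e`**: on a MODE-0 edge (`t j = 0`) from a clean `q`-fold (`q = p^e`,
`e ≥ 1`) `V_q`-inactive state, `ω_q′ ≤ ω_q + (p^{e−1} − 1)`. [folklore] -/
theorem omegaLetter_step_le_add_of_not_isVActive (p : ℕ) [Fact p.Prime] [CharP K p] {e : ℕ} (he : 1 ≤ e)
    (s : CState σ K) (j : σ) (t : σ → K) (ht : t j = 0) (hclean : IsClean (p ^ e) s.F)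
    (hq : ((p ^ e : ℕ) : ℕ∞) ≤ ordZero s.F) (hV : ¬ IsVActive (p ^ e) s.exc s.F) :
    omegaLetter (p ^ e) (CentreBlowup.step (p ^ e) Finset.univ j t s).exc (CentreBlowup.step (p ^ e) Finset.univ j t s).F ≤
      omegaLetter (p ^ e) s.exc s.F + ((p ^ (e - 1) - 1 : ℕ) : ℕ∞) := by
  have hπ : 1 ≤ p ^ (e - 1) := Nat.one_le_pow _ _ (Fact.out : p.Prime).pos
  unfold omegaLetter
  rw [if_neg hV, tsub_zero]
  by_cases hF0 : s.F = 0
  · rw [hF0, residualOrder_zero, top_add]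
    exact le_top
  have hA := residualOrder_step_le_add_pow p he s j t ht hclean hq
  have hne : (CentreBlowup.step (p ^ e) Finset.univ j t s).F ≠ 0 :=
    step_F_ne_zero_of_isClean p e s j t ht hclean hF0 hq
  obtain ⟨o, ho⟩ := exists_ordZero_eq_natCast hF0
  obtain ⟨-, hd⟩ := residualOrder_eq_ordZero_sub s.exc ho
  obtain ⟨o', ho'⟩ := exists_ordZero_eq_natCast hne
  obtain ⟨-, hd'⟩ := residualOrder_eq_ordZero_sub (CentreBlowup.step (p ^ e) Finset.univ j t s).exc ho'
  by_cases hext : residualOrder s.exc s.F + ((p ^ (e - 1) : ℕ) : ℕ∞) ≤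
      residualOrder (CentreBlowup.step (p ^ e) Finset.univ j t s).exc (CentreBlowup.step (p ^ e) Finset.univ j t s).F
  · have hV' := isVActive_step_of_residualOrder_add_pow_le p e s j t ht hclean hq hF0 hext
    rw [if_pos hV']
    rw [hd, hd'] at hA ⊢
    rw [← ENat.coe_add, Nat.cast_le] at hA
    rw [show (1 : ℕ∞) = ((1 : ℕ) : ℕ∞) from rfl, ← ENat.coe_sub, ← ENat.coe_add, Nat.cast_le]
    omega
  · rw [hd, hd'] at hext ⊢
    rw [← ENat.coe_add, Nat.cast_le, not_le] at hext
    refine tsub_le_self.trans ?_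
    rw [← ENat.coe_add, Nat.cast_le]
    omega

open Classical in
/-- **THE MOVE LAW OF `ω_q` (res-dim4-idea-5), every `e ≥ 1`**: on every MODE-0 edge (`t j = 0`) from a clean
`q`-fold state (`q = p^e`), every field of characteristic `p`, any number of variables:
`ω_q′ ≤ ω_q + [V_q = 0]·(p^{e−1} − 1)` — no rise from a `V_q`-active state (Π), a rise of at most `p^{e−1} − 1` from a
`V_q`-inactive one.  At `e = 1` this is `omegaLetter_mode0_le`.  A per-edge BOUND, not a monotonicity for `e ≥ 2`.
[folklore] -/
theorem omegaLetter_move_law (p : ℕ) [Fact p.Prime] [CharP K p] {e : ℕ} (he : 1 ≤ e) (s : CState σ K) (j : σ)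
    (t : σ → K) (ht : t j = 0) (hclean : IsClean (p ^ e) s.F) (hq : ((p ^ e : ℕ) : ℕ∞) ≤ ordZero s.F) :
    omegaLetter (p ^ e) (CentreBlowup.step (p ^ e) Finset.univ j t s).exc (CentreBlowup.step (p ^ e) Finset.univ j t s).F ≤
      omegaLetter (p ^ e) s.exc s.F +
        (if IsVActive (p ^ e) s.exc s.F then 0 else ((p ^ (e - 1) - 1 : ℕ) : ℕ∞)) := by
  split_ifs with hV
  · rw [add_zero]
    exact omegaLetter_step_le p e s j t ht hq hV
  · exact omegaLetter_step_le_add_of_not_isVActive p he s j t ht hclean hq hV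

end Plateau

end Summit.ResolutionOfSingularities.ResolutionOfSingularities.Theorems.PIDim4
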